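import Summits.HodgeConjecture.HodgeConjecture.Theorems.Ring2WeilCoverageQuarticNormObstruction
import Summits.HodgeConjecture.HodgeConjecture.Theorems.Ring2WeilCoverageCyclotomicConditionalNoRows
import Summits.HodgeConjecture.HodgeConjecture.Theorems.Ring2WeilCoverageRealQuadraticUnitNorm
import HarnessLib

/-!
# Weil-type family coverage — THEOREM L (i) PROVED at `M = 35, 45`; the last four rows of the `h = 1` census
# (`(35, ℚ(√−7))`, `(35, ℚ(√−35))`, `(45, ℚ(√−3))`, `(45, ℚ(√−15))`) are UNCONDITIONAL NO rows

research route conditional on HC_CM; not a corollary; Q11.4-sentence-2 already refuted in dim ≥ 3.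

Ring 2, WEIL-TYPE FAMILY-COVERAGE CENSUS (`HOME/WEIL-FAMILY-COVERAGE.md` `## b01`, blocks b01.28 THEOREM L (i), b01.34 (D),
b01.36 (D)/(E); owner ring2-b01), part 31 of the `Ring2WeilCoverage*` series.  Part 29 (`…CyclotomicConditionalNoRows`)
stated the four NO rows at the `g = 12` levels `35, 45` modulo the single hypothesis
`hN : ∀ v ∈ 𝓞(ℚ(ζ_M)⁺)ˣ, 0 < N(v)` (THEOREM L (i)); part 30 (`…QuarticNormObstruction.norm_ne_neg_one`) proved,
elementarily, that a number field containing `s, w` with `s² = 5`, `2w² = q(5 + s)` (`q = 3, 7`) has no element of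
norm `−1`.  THIS FILE exhibits such `s, w` in `ℚ(ζ₃₅)⁺` and `ℚ(ζ₄₅)⁺` and discharges `hN`:

* §1 `M = 35`: with `z = ζ⁷` (a primitive 5th root) and `η = ζ⁵` (a primitive 7th root), `s = 1 + 2(z + z⁴)` (`= √5`),
  `w = (z − z⁴)·(1 + 2(η + η² + η⁴))` (`= √(−(5+√5)/2) · √−7`): `s² = 5` (`sq_sqrtFive`), `(z − z⁴)² = −(3 + z + z⁴)`
  (`sq_sub_pow_four`), `(1 + 2(η + η² + η⁴))² = −7` (`sq_gaussSeven`), so `2w² = 7(5 + s)`; both are fixed by complex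
  conjugation `ζ ↦ ζ⁻¹` (each factor of `w` is negated) — **`norm_ne_neg_one_thirtyFive`**: NO element of `ℚ(ζ₃₅)⁺`
  has norm `−1`; **`norm_realUnits_pos_thirtyFive`**: every unit of `𝓞(ℚ(ζ₃₅)⁺)` has norm `+1` (`±1` and `≠ −1`).
* §2 `M = 45`: `z = ζ⁹`, `ω = ζ¹⁵`, `s = 1 + 2(z + z⁴)`, `w = (z − z⁴)(1 + 2ω)` (`(1 + 2ω)² = −3`, `2w² = 3(5 + s)`;
  `ℚ(s, w) = ℚ(ζ₁₅)⁺`) — **`norm_ne_neg_one_fortyFive`**, **`norm_realUnits_pos_fortyFive`**.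
* §3 **the four rows, hypothesis-free**: `not_exists_principal_thirtyFive_sqrt_neg_seven / thirtyFive_sqrt_neg_thirtyFive /
  fortyFive_sqrt_neg_three / fortyFive_sqrt_neg_fifteen` — for any `K` with `IsCyclotomicExtension {M} ℚ K`, `[IsCMField K]`,
  and any CM type `Φ` balanced for the displayed `N_K`, the principal CM torus `ℂ^Φ/Φ(ℤ[ζ_M])` carries NO
  `ι`-compatible principal polarisation (part 29's theorems with `hN` supplied).  WITH THIS, ALL 32 ROWS `(M, K)` OF
  THE `h(ℚ(ζ_M)) = 1` CENSUS ARE HYPOTHESIS-FREE TREE THEOREMS (23 YES: parts 12–22; 9 NO: parts 9, 10 and this file).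

HONEST FRAMING: elementary cyclotomic identities + part 30; statements about units of `ℚ(ζ_M)⁺` and Shimura's divisors
of principal type on `ℂ^Φ/Φ(ℤ[ζ_M])`; nothing about Hodge classes, `W_K`, general members or HC; `HC_CM` is used
nowhere.  No `def`, no named fact, no `sorry`.

References: [folklore] (Gauss periods of `5, 7, 3`); [cite: Shimura1998, §14.3 Prop. 4–5, pp. 103–104] for the rows;
census b01.28 THEOREM L (i), b01.36 (E) (seat-derived).
-/

noncomputable section

open Polynomial NumberField Complex Finset
open scoped Real nonZeroDivisors

namespace Summit.HodgeConjecture.Ring2WeilCoverage.CyclotomicUnconditionalSqrtFive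

open Summit.HodgeConjecture.Ring2WeilCoverage.RealQuadraticUnitNorm (complexConj_eq_inv_of_pow_eq_one)
open Summit.HodgeConjecture.Ring2WeilCoverage.QuarticNormObstruction (norm_ne_neg_one)

section Elements

variable {K : Type*} [Field K]

/-- **`(1 + 2(z + z⁴))² = 5`** for a primitive 5th root of unity `z` (`1 + 2(z + z⁻¹) = √5` up to sign; Gauss period).
research route conditional on HC_CM; not a corollary; Q11.4-sentence-2 already refuted in dim ≥ 3. [folklore] -/
theorem sq_sqrtFive {z : K} (hz : IsPrimitiveRoot z 5) : (1 + 2 * (z + z ^ 4)) ^ 2 = (5 : K) := by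
  have h5 := hz.geom_sum_eq_zero (by norm_num : 1 < 5)
  simp only [Finset.sum_range_succ, Finset.sum_range_zero, zero_add, pow_zero, pow_one] at h5
  have hz5 : z ^ 5 = 1 := hz.pow_eq_one
  linear_combination (4 : K) * h5 + (8 + 4 * z ^ 3) * hz5

/-- **`(z − z⁴)² = −(3 + z + z⁴)`** (`= −(5 + √5)/2` with `√5 = 1 + 2(z + z⁴)`) for a primitive 5th root `z`.
research route conditional on HC_CM; not a corollary; Q11.4-sentence-2 already refuted in dim ≥ 3. [folklore] -/
theorem sq_sub_pow_four {z : K} (hz : IsPrimitiveRoot z 5) : (z - z ^ 4) ^ 2 = -(3 + (z + z ^ 4)) := by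
  have h5 := hz.geom_sum_eq_zero (by norm_num : 1 < 5)
  simp only [Finset.sum_range_succ, Finset.sum_range_zero, zero_add, pow_zero, pow_one] at h5
  have hz5 : z ^ 5 = 1 := hz.pow_eq_one
  linear_combination h5 + (z ^ 3 - 2) * hz5

/-- **`(1 + 2(η + η² + η⁴))² = −7`** for a primitive 7th root `η` (the quadratic Gauss sum of `7`).
research route conditional on HC_CM; not a corollary; Q11.4-sentence-2 already refuted in dim ≥ 3. [folklore] -/
theorem sq_gaussSeven {η : K} (hη : IsPrimitiveRoot η 7) : (1 + 2 * (η + η ^ 2 + η ^ 4)) ^ 2 = (-7 : K) := by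
  have h7 := hη.geom_sum_eq_zero (by norm_num : 1 < 7)
  simp only [Finset.sum_range_succ, Finset.sum_range_zero, zero_add, pow_zero, pow_one] at h7
  have hη7 : η ^ 7 = 1 := hη.pow_eq_one
  linear_combination (4 * η) * hη7 + 8 * h7

/-- **`(1 + 2ω)² = −3`** for a primitive cube root `ω`.
research route conditional on HC_CM; not a corollary; Q11.4-sentence-2 already refuted in dim ≥ 3. [folklore] -/
theorem sq_gaussThree {ω : K} (hω : IsPrimitiveRoot ω 3) : (1 + 2 * ω) ^ 2 = (-3 : K) := by
  have h3 := hω.geom_sum_eq_zero (by norm_num : 1 < 3)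
  simp only [Finset.sum_range_succ, Finset.sum_range_zero, zero_add, pow_zero, pow_one] at h3
  linear_combination (4 : K) * h3

variable [NumberField K] [IsCMField K]

/-- Complex conjugation sends a primitive 5th root `z` to `z⁴`, hence FIXES `1 + 2(z + z⁴)` and NEGATES `z − z⁴`.
research route conditional on HC_CM; not a corollary; Q11.4-sentence-2 already refuted in dim ≥ 3. [folklore] -/
theorem complexConj_five {z : K} (hz : IsPrimitiveRoot z 5) :
    IsCMField.complexConj K (1 + 2 * (z + z ^ 4)) = 1 + 2 * (z + z ^ 4) ∧
      IsCMField.complexConj K (z - z ^ 4) = -(z - z ^ 4) := by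
  have hz5 : z ^ 5 = 1 := hz.pow_eq_one
  have hc : IsCMField.complexConj K z = z ^ 4 := by
    rw [complexConj_eq_inv_of_pow_eq_one (by norm_num) hz5]
    exact inv_eq_of_mul_eq_one_right (by linear_combination hz5)
  simp only [map_add, map_sub, map_mul, map_one, map_ofNat, map_pow, hc]
  constructor
  · linear_combination (2 * z * (z ^ 10 + z ^ 5 + 1)) * hz5
  · linear_combination (-(z * (z ^ 10 + z ^ 5 + 1))) * hz5

/-- Complex conjugation NEGATES the Gauss sum `1 + 2(η + η² + η⁴)` of `7` (`η⁻¹ + η⁻² + η⁻⁴ = η⁶ + η⁵ + η³`).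
research route conditional on HC_CM; not a corollary; Q11.4-sentence-2 already refuted in dim ≥ 3. [folklore] -/
theorem complexConj_gaussSeven {η : K} (hη : IsPrimitiveRoot η 7) :
    IsCMField.complexConj K (1 + 2 * (η + η ^ 2 + η ^ 4)) = -(1 + 2 * (η + η ^ 2 + η ^ 4)) := by
  have h7 := hη.geom_sum_eq_zero (by norm_num : 1 < 7)
  simp only [Finset.sum_range_succ, Finset.sum_range_zero, zero_add, pow_zero, pow_one] at h7
  have hη7 : η ^ 7 = 1 := hη.pow_eq_one
  have hc : IsCMField.complexConj K η = η ^ 6 := by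
    rw [complexConj_eq_inv_of_pow_eq_one (by norm_num) hη7]
    exact inv_eq_of_mul_eq_one_right (by linear_combination hη7)
  simp only [map_add, map_mul, map_one, map_ofNat, map_pow, hc]
  linear_combination (2 : K) * h7 + (2 * η ^ 5 + 2 * η ^ 3 * ((η ^ 7) ^ 2 + η ^ 7 + 1)) * hη7

/-- Complex conjugation NEGATES `1 + 2ω` for a primitive cube root `ω` (`1 + 2ω² = −(1 + 2ω)`).
research route conditional on HC_CM; not a corollary; Q11.4-sentence-2 already refuted in dim ≥ 3. [folklore] -/
theorem complexConj_gaussThree {ω : K} (hω : IsPrimitiveRoot ω 3) :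
    IsCMField.complexConj K (1 + 2 * ω) = -(1 + 2 * ω) := by
  have h3 := hω.geom_sum_eq_zero (by norm_num : 1 < 3)
  simp only [Finset.sum_range_succ, Finset.sum_range_zero, zero_add, pow_zero, pow_one] at h3
  have hω3 : ω ^ 3 = 1 := hω.pow_eq_one
  have hc : IsCMField.complexConj K ω = ω ^ 2 := by
    rw [complexConj_eq_inv_of_pow_eq_one (by norm_num) hω3]
    exact inv_eq_of_mul_eq_one_right (by linear_combination hω3)
  simp only [map_add, map_mul, map_one, map_ofNat, hc]
  linear_combination (2 : K) * h3

/-- The norm of a unit of `𝓞 L` is `+1` once `−1` is excluded.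
research route conditional on HC_CM; not a corollary; Q11.4-sentence-2 already refuted in dim ≥ 3. [folklore] -/
theorem norm_units_pos_of_ne {L : Type*} [Field L] [NumberField L] (v : (𝓞 L)ˣ)
    (hne : Algebra.norm ℚ (((v : 𝓞 L)) : L) ≠ -1) : 0 < Algebra.norm ℚ (((v : 𝓞 L)) : L) := by
  have hunit : IsUnit (Algebra.norm ℤ (v : 𝓞 L)) := v.isUnit.map _
  rw [← Algebra.coe_norm_int] at hne ⊢
  rcases Int.isUnit_iff.mp hunit with h1 | h1
  · rw [h1]; norm_num
  · rw [h1] at hne; norm_num at hne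

/-! ### §1 `M = 35`: `√5` and `√(7(5+√5)/2)` lie in `ℚ(ζ₃₅)⁺` -/

/-- **THEOREM L (i) AT `M = 35`, PROVED: every unit `v` of `𝓞(ℚ(ζ₃₅)⁺)` has `0 < N_{ℚ(ζ₃₅)⁺/ℚ}(v)`** — the hypothesis
`hN` of parts 7/29 at `35`, for any `K` with `IsCyclotomicExtension {35} ℚ K`, `[IsCMField K]`.  (`ℚ(ζ₃₅)⁺ ∋ s = 1 + 2(ζ⁷ + ζ²⁸)`,
`w = (ζ⁷ − ζ²⁸)(1 + 2(ζ⁵ + ζ¹⁰ + ζ²⁰))` with `s² = 5`, `2w² = 7(5 + s)`; part 30 with `q = 7`: `7 ≡ 3 (4)`, `(5/7) = −1`.)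
research route conditional on HC_CM; not a corollary; Q11.4-sentence-2 already refuted in dim ≥ 3. [folklore] -/
theorem norm_realUnits_pos_thirtyFive [IsCyclotomicExtension {35} ℚ K] {ζ : K} (hζ : IsPrimitiveRoot ζ 35)
    (v : (𝓞 (maximalRealSubfield K))ˣ) :
    0 < Algebra.norm ℚ (((v : 𝓞 (maximalRealSubfield K)) : maximalRealSubfield K)) := by
  have hz : IsPrimitiveRoot (ζ ^ 7) 5 := hζ.pow (by norm_num) (by norm_num)
  have hη : IsPrimitiveRoot (ζ ^ 5) 7 := hζ.pow (by norm_num) (by norm_num)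
  set s₀ : K := 1 + 2 * (ζ ^ 7 + (ζ ^ 7) ^ 4) with hs₀
  set w₀ : K := (ζ ^ 7 - (ζ ^ 7) ^ 4) * (1 + 2 * (ζ ^ 5 + (ζ ^ 5) ^ 2 + (ζ ^ 5) ^ 4)) with hw₀
  have hsm : s₀ ∈ maximalRealSubfield K :=
    (IsCMField.complexConj_eq_self_iff K s₀).mp (complexConj_five hz).1
  have hwm : w₀ ∈ maximalRealSubfield K := by
    refine (IsCMField.complexConj_eq_self_iff K w₀).mp ?_
    rw [hw₀, map_mul, (complexConj_five hz).2, complexConj_gaussSeven hη]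
    ring
  set s : maximalRealSubfield K := ⟨s₀, hsm⟩ with hs
  set w : maximalRealSubfield K := ⟨w₀, hwm⟩ with hw
  have hs2 : s ^ 2 = 5 := by
    apply Subtype.ext
    push_cast
    exact sq_sqrtFive hz
  have hw₀' : (2 : K) * w₀ ^ 2 = 7 * (5 + s₀) := by
    rw [hw₀, hs₀, mul_pow, sq_sub_pow_four hz, sq_gaussSeven hη]
    ring
  have hw2 : 2 * w ^ 2 = (7 : ℕ) * (5 + s) := by
    apply Subtype.ext
    push_cast
    exact hw₀'
  refine norm_units_pos_of_ne v (norm_ne_neg_one (q := 7) (by norm_num) (by norm_num) (by decide)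
    (by norm_num) hs2 hw2 _)

/-- **No ELEMENT of `ℚ(ζ₃₅)⁺` has norm `−1`** (not only no unit): `N_{K⁺/ℚ}(x) ≠ −1` for every `x ∈ K⁺`, `K` any field with
`IsCyclotomicExtension {35} ℚ K`, `[IsCMField K]` — part 30's `norm_ne_neg_one` with `s, w ∈ K⁺` as above.
research route conditional on HC_CM; not a corollary; Q11.4-sentence-2 already refuted in dim ≥ 3. [folklore] -/
theorem norm_ne_neg_one_thirtyFive [IsCyclotomicExtension {35} ℚ K] {ζ : K} (hζ : IsPrimitiveRoot ζ 35)
    (x : maximalRealSubfield K) : Algebra.norm ℚ x ≠ -1 := by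
  have hz : IsPrimitiveRoot (ζ ^ 7) 5 := hζ.pow (by norm_num) (by norm_num)
  have hη : IsPrimitiveRoot (ζ ^ 5) 7 := hζ.pow (by norm_num) (by norm_num)
  have hsm : (1 + 2 * (ζ ^ 7 + (ζ ^ 7) ^ 4)) ∈ maximalRealSubfield K :=
    (IsCMField.complexConj_eq_self_iff K _).mp (complexConj_five hz).1
  have hwm : (ζ ^ 7 - (ζ ^ 7) ^ 4) * (1 + 2 * (ζ ^ 5 + (ζ ^ 5) ^ 2 + (ζ ^ 5) ^ 4)) ∈ maximalRealSubfield K := by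
    refine (IsCMField.complexConj_eq_self_iff K _).mp ?_
    rw [map_mul, (complexConj_five hz).2, complexConj_gaussSeven hη]
    ring
  have hs2 : (⟨_, hsm⟩ : maximalRealSubfield K) ^ 2 = 5 := by
    apply Subtype.ext
    push_cast
    exact sq_sqrtFive hz
  have hw₀' : (2 : K) * ((ζ ^ 7 - (ζ ^ 7) ^ 4) * (1 + 2 * (ζ ^ 5 + (ζ ^ 5) ^ 2 + (ζ ^ 5) ^ 4))) ^ 2 =
      7 * (5 + (1 + 2 * (ζ ^ 7 + (ζ ^ 7) ^ 4))) := by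
    rw [mul_pow, sq_sub_pow_four hz, sq_gaussSeven hη]
    ring
  have hw2 : 2 * (⟨_, hwm⟩ : maximalRealSubfield K) ^ 2 = (7 : ℕ) * (5 + ⟨_, hsm⟩) := by
    apply Subtype.ext
    push_cast
    exact hw₀'
  exact norm_ne_neg_one (q := 7) (by norm_num) (by norm_num) (by decide) (by norm_num) hs2 hw2 x

/-! ### §2 `M = 45`: `√5` and `√(3(5+√5)/2)` lie in `ℚ(ζ₄₅)⁺` (indeed in `ℚ(ζ₁₅)⁺`) -/

/-- **THEOREM L (i) AT `M = 45`, PROVED: every unit `v` of `𝓞(ℚ(ζ₄₅)⁺)` has `0 < N_{ℚ(ζ₄₅)⁺/ℚ}(v)`** — the hypothesis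
`hN` of parts 7/29 at `45`, for any `K` with `IsCyclotomicExtension {45} ℚ K`, `[IsCMField K]`.  (`ℚ(ζ₄₅)⁺ ∋ s = 1 + 2(ζ⁹ + ζ³⁶)`,
`w = (ζ⁹ − ζ³⁶)(1 + 2ζ¹⁵)` with `s² = 5`, `2w² = 3(5 + s)`; part 30 with `q = 3`: `3 ≡ 3 (4)`, `(5/3) = −1`.)
research route conditional on HC_CM; not a corollary; Q11.4-sentence-2 already refuted in dim ≥ 3. [folklore] -/
theorem norm_realUnits_pos_fortyFive [IsCyclotomicExtension {45} ℚ K] {ζ : K} (hζ : IsPrimitiveRoot ζ 45)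
    (v : (𝓞 (maximalRealSubfield K))ˣ) :
    0 < Algebra.norm ℚ (((v : 𝓞 (maximalRealSubfield K)) : maximalRealSubfield K)) := by
  have hz : IsPrimitiveRoot (ζ ^ 9) 5 := hζ.pow (by norm_num) (by norm_num)
  have hω : IsPrimitiveRoot (ζ ^ 15) 3 := hζ.pow (by norm_num) (by norm_num)
  set s₀ : K := 1 + 2 * (ζ ^ 9 + (ζ ^ 9) ^ 4) with hs₀
  set w₀ : K := (ζ ^ 9 - (ζ ^ 9) ^ 4) * (1 + 2 * ζ ^ 15) with hw₀
  have hsm : s₀ ∈ maximalRealSubfield K :=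
    (IsCMField.complexConj_eq_self_iff K s₀).mp (complexConj_five hz).1
  have hwm : w₀ ∈ maximalRealSubfield K := by
    refine (IsCMField.complexConj_eq_self_iff K w₀).mp ?_
    rw [hw₀, map_mul, (complexConj_five hz).2, complexConj_gaussThree hω]
    ring
  set s : maximalRealSubfield K := ⟨s₀, hsm⟩ with hs
  set w : maximalRealSubfield K := ⟨w₀, hwm⟩ with hw
  have hs2 : s ^ 2 = 5 := by
    apply Subtype.ext
    push_cast
    exact sq_sqrtFive hz
  have hw₀' : (2 : K) * w₀ ^ 2 = 3 * (5 + s₀) := by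
    rw [hw₀, hs₀, mul_pow, sq_sub_pow_four hz, sq_gaussThree hω]
    ring
  have hw2 : 2 * w ^ 2 = (3 : ℕ) * (5 + s) := by
    apply Subtype.ext
    push_cast
    exact hw₀'
  refine norm_units_pos_of_ne v (norm_ne_neg_one (q := 3) (by norm_num) (by norm_num) (by decide)
    (by norm_num) hs2 hw2 _)

/-- **No ELEMENT of `ℚ(ζ₄₅)⁺` has norm `−1`**: `N_{K⁺/ℚ}(x) ≠ −1` for every `x ∈ K⁺`, `K` any field with
`IsCyclotomicExtension {45} ℚ K`, `[IsCMField K]` (part 30's `norm_ne_neg_one` with `q = 3`).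
research route conditional on HC_CM; not a corollary; Q11.4-sentence-2 already refuted in dim ≥ 3. [folklore] -/
theorem norm_ne_neg_one_fortyFive [IsCyclotomicExtension {45} ℚ K] {ζ : K} (hζ : IsPrimitiveRoot ζ 45)
    (x : maximalRealSubfield K) : Algebra.norm ℚ x ≠ -1 := by
  have hz : IsPrimitiveRoot (ζ ^ 9) 5 := hζ.pow (by norm_num) (by norm_num)
  have hω : IsPrimitiveRoot (ζ ^ 15) 3 := hζ.pow (by norm_num) (by norm_num)
  have hsm : (1 + 2 * (ζ ^ 9 + (ζ ^ 9) ^ 4)) ∈ maximalRealSubfield K :=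
    (IsCMField.complexConj_eq_self_iff K _).mp (complexConj_five hz).1
  have hwm : (ζ ^ 9 - (ζ ^ 9) ^ 4) * (1 + 2 * ζ ^ 15) ∈ maximalRealSubfield K := by
    refine (IsCMField.complexConj_eq_self_iff K _).mp ?_
    rw [map_mul, (complexConj_five hz).2, complexConj_gaussThree hω]
    ring
  have hs2 : (⟨_, hsm⟩ : maximalRealSubfield K) ^ 2 = 5 := by
    apply Subtype.ext
    push_cast
    exact sq_sqrtFive hz
  have hw₀' : (2 : K) * ((ζ ^ 9 - (ζ ^ 9) ^ 4) * (1 + 2 * ζ ^ 15)) ^ 2 = 3 * (5 + (1 + 2 * (ζ ^ 9 + (ζ ^ 9) ^ 4))) := by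
    rw [mul_pow, sq_sub_pow_four hz, sq_gaussThree hω]
    ring
  have hw2 : 2 * (⟨_, hwm⟩ : maximalRealSubfield K) ^ 2 = (3 : ℕ) * (5 + ⟨_, hsm⟩) := by
    apply Subtype.ext
    push_cast
    exact hw₀'
  exact norm_ne_neg_one (q := 3) (by norm_num) (by norm_num) (by decide) (by norm_num) hs2 hw2 x

end Elements

/-! ### §3 The four NO rows at `35, 45`, now hypothesis-free -/

section Rows

open Literature.AlgebraicGeometry.Motives (CMType)
open Literature.NumberTheory.ComplexMultiplication

variable {K : Type} [Field K] [NumberField K] [IsCMField K] {ζ : K}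

/-- `𝐞(t) = exp(2πi t/M) ∈ ℂ` (`ZMod.toCircle`). -/
local notation3 (prettyPrint := false) "𝐞 " t:max => ((ZMod.toCircle t : Circle) : ℂ)

open scoped Classical in
/-- **Census row `(ℚ(ζ_35), ℚ(√−7))` — NO, UNCONDITIONALLY**: for any `K` with `IsCyclotomicExtension {35} ℚ K`,
`[IsCMField K]`, and any CM type `Φ` balanced for `N_K = {3, 6, 12, 13, 17, 19, 24, 26, 27, 31, 33, 34}` (`n₋ = 5`, odd),
the principal CM torus `ℂ^Φ/Φ(ℤ[ζ_35])` carries NO `ι`-compatible principal polarisation (part 29 + THEOREM L (i) at 35).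
research route conditional on HC_CM; not a corollary; Q11.4-sentence-2 already refuted in dim ≥ 3. [cite: Shimura1998, §14.3 Prop. 5, p. 104] -/
theorem not_exists_principal_thirtyFive_sqrt_neg_seven [IsCyclotomicExtension {35} ℚ K]
    (hζ : IsPrimitiveRoot ζ 35) (Φ : CMType K)
    (hbal : 2 * ((Finset.univ.filter fun t : ZMod 35 => ∃ σ ∈ Φ.1, σ ζ = 𝐞 t) ∩
        ({3, 6, 12, 13, 17, 19, 24, 26, 27, 31, 33, 34} : Finset (ZMod 35))).card =
      (Finset.univ.filter fun t : ZMod 35 => ∃ σ ∈ Φ.1, σ ζ = 𝐞 t).card) :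
    ¬ ∃ ζ' : K, IsCMField.complexConj K ζ' = -ζ' ∧ (∀ φ : Φ.1, 0 < (φ.1 ζ').im) ∧
        CMTypeLattice.IsOfType (1 : (FractionalIdeal (𝓞 K)⁰ K)ˣ) ζ' ⊤ :=
  CyclotomicConditionalNoRows.not_exists_principal_thirtyFive_sqrt_neg_seven hζ Φ hbal (norm_realUnits_pos_thirtyFive hζ)

open scoped Classical in
/-- **Census row `(ℚ(ζ_35), ℚ(√−35))` — NO, UNCONDITIONALLY**: for any `K` with `IsCyclotomicExtension {35} ℚ K`,
`[IsCMField K]`, and any CM type `Φ` balanced for `N_K = {2, 6, 8, 18, 19, 22, 23, 24, 26, 31, 32, 34}` (`n₋ = 3`, odd),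
the principal CM torus `ℂ^Φ/Φ(ℤ[ζ_35])` carries NO `ι`-compatible principal polarisation (part 29 + THEOREM L (i) at 35).
research route conditional on HC_CM; not a corollary; Q11.4-sentence-2 already refuted in dim ≥ 3. [cite: Shimura1998, §14.3 Prop. 5, p. 104] -/
theorem not_exists_principal_thirtyFive_sqrt_neg_thirtyFive [IsCyclotomicExtension {35} ℚ K]
    (hζ : IsPrimitiveRoot ζ 35) (Φ : CMType K)
    (hbal : 2 * ((Finset.univ.filter fun t : ZMod 35 => ∃ σ ∈ Φ.1, σ ζ = 𝐞 t) ∩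
        ({2, 6, 8, 18, 19, 22, 23, 24, 26, 31, 32, 34} : Finset (ZMod 35))).card =
      (Finset.univ.filter fun t : ZMod 35 => ∃ σ ∈ Φ.1, σ ζ = 𝐞 t).card) :
    ¬ ∃ ζ' : K, IsCMField.complexConj K ζ' = -ζ' ∧ (∀ φ : Φ.1, 0 < (φ.1 ζ').im) ∧
        CMTypeLattice.IsOfType (1 : (FractionalIdeal (𝓞 K)⁰ K)ˣ) ζ' ⊤ :=
  CyclotomicConditionalNoRows.not_exists_principal_thirtyFive_sqrt_neg_thirtyFive hζ Φ hbal (norm_realUnits_pos_thirtyFive hζ)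

open scoped Classical in
/-- **Census row `(ℚ(ζ_45), ℚ(√−3))` — NO, UNCONDITIONALLY**: for any `K` with `IsCyclotomicExtension {45} ℚ K`,
`[IsCMField K]`, and any CM type `Φ` balanced for `N_K = {2, 8, 11, 14, 17, 23, 26, 29, 32, 38, 41, 44}` (`n₋ = 5`, odd),
the principal CM torus `ℂ^Φ/Φ(ℤ[ζ_45])` carries NO `ι`-compatible principal polarisation (part 29 + THEOREM L (i) at 45).
research route conditional on HC_CM; not a corollary; Q11.4-sentence-2 already refuted in dim ≥ 3. [cite: Shimura1998, §14.3 Prop. 5, p. 104] -/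
theorem not_exists_principal_fortyFive_sqrt_neg_three [IsCyclotomicExtension {45} ℚ K]
    (hζ : IsPrimitiveRoot ζ 45) (Φ : CMType K)
    (hbal : 2 * ((Finset.univ.filter fun t : ZMod 45 => ∃ σ ∈ Φ.1, σ ζ = 𝐞 t) ∩
        ({2, 8, 11, 14, 17, 23, 26, 29, 32, 38, 41, 44} : Finset (ZMod 45))).card =
      (Finset.univ.filter fun t : ZMod 45 => ∃ σ ∈ Φ.1, σ ζ = 𝐞 t).card) :
    ¬ ∃ ζ' : K, IsCMField.complexConj K ζ' = -ζ' ∧ (∀ φ : Φ.1, 0 < (φ.1 ζ').im) ∧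
        CMTypeLattice.IsOfType (1 : (FractionalIdeal (𝓞 K)⁰ K)ˣ) ζ' ⊤ :=
  CyclotomicConditionalNoRows.not_exists_principal_fortyFive_sqrt_neg_three hζ Φ hbal (norm_realUnits_pos_fortyFive hζ)

open scoped Classical in
/-- **Census row `(ℚ(ζ_45), ℚ(√−15))` — NO, UNCONDITIONALLY**: for any `K` with `IsCyclotomicExtension {45} ℚ K`,
`[IsCMField K]`, and any CM type `Φ` balanced for `N_K = {7, 11, 13, 14, 22, 26, 28, 29, 37, 41, 43, 44}` (`n₋ = 5`, odd),
the principal CM torus `ℂ^Φ/Φ(ℤ[ζ_45])` carries NO `ι`-compatible principal polarisation (part 29 + THEOREM L (i) at 45).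
research route conditional on HC_CM; not a corollary; Q11.4-sentence-2 already refuted in dim ≥ 3. [cite: Shimura1998, §14.3 Prop. 5, p. 104] -/
theorem not_exists_principal_fortyFive_sqrt_neg_fifteen [IsCyclotomicExtension {45} ℚ K]
    (hζ : IsPrimitiveRoot ζ 45) (Φ : CMType K)
    (hbal : 2 * ((Finset.univ.filter fun t : ZMod 45 => ∃ σ ∈ Φ.1, σ ζ = 𝐞 t) ∩
        ({7, 11, 13, 14, 22, 26, 28, 29, 37, 41, 43, 44} : Finset (ZMod 45))).card =
      (Finset.univ.filter fun t : ZMod 45 => ∃ σ ∈ Φ.1, σ ζ = 𝐞 t).card) :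
    ¬ ∃ ζ' : K, IsCMField.complexConj K ζ' = -ζ' ∧ (∀ φ : Φ.1, 0 < (φ.1 ζ').im) ∧
        CMTypeLattice.IsOfType (1 : (FractionalIdeal (𝓞 K)⁰ K)ˣ) ζ' ⊤ :=
  CyclotomicConditionalNoRows.not_exists_principal_fortyFive_sqrt_neg_fifteen hζ Φ hbal (norm_realUnits_pos_fortyFive hζ)

end Rows

end Summit.HodgeConjecture.Ring2WeilCoverage.CyclotomicUnconditionalSqrtFive

end
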